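import Summits.Ventures.WeilGRH.UniformConductorFloorCoprimeData57Log8
import Summits.Ventures.WeilGRH.UniformConductorFloorJointFloorsLog8
import Summits.Ventures.WeilGRH.UniformConductorFloorCellsOne
import Summits.Ventures.WeilGRH.UniformConductorFloorRungs
import HarnessLib

/-!
# GRH arm (rh-explicit, venture WeilGRH): divisibility floors at `t = (log 8)/2`, levels `5, 7, 10, 15` — the transcendental inputs

Cell `rh-explicit`, WEIL TRACK — GRH ARM (weil-grh-1, gen9).  For the four EVEN joint cell certificates of
`UniformConductorFloorCoprimeData57Log8.lean` (level `m ∈ {5, 7, 10, 15}`, grid `R = 320`, `J = 333`, prime powers `n ≤ 8`): the weight bounds on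
the `n` PRIME TO `m` (`UniformFloor.wbar7_ge`, `vonMangoldt_eight_div_sqrt_le`; the other weights are `0`) and the four budget inequalities
`log π − ψ₀ − Clow/D + RHO/D ≤ log Q₀` (`certEvenDvd5Log8` → Q₀ = 70; `certEvenDvd7Log8` → Q₀ = 91; `certEvenDvd10Log8` → Q₀ = 30; `certEvenDvd15Log8` → Q₀ = 45; elementary logarithm bounds from `log 2`, `log 3` inline).  The window
`(log 8)/2 ≤ 333 log(320/319)` is the tree's `UniformFloor.log8half_le_t`.  Consumed by `UniformConductorFloorCoprimeFloors57Log8.lean`.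
No definitions; no named facts; standard axioms. [folklore]
-/

noncomputable section

open Real Set
open scoped ArithmeticFunction.vonMangoldt

namespace Summit.Ventures.WeilGRH

open Literature.NumberTheory.LFunctions

namespace UniformFloor

/-! ## The weights -/

/-- The weights of `certEvenDvd5Log8` dominate `Λ(n)/√n` on the `n ≤ 8` prime to `5`; the other weights are `0`. [folklore] -/
theorem certEvenDvd5Log8_hw : ∀ n ∈ Finset.range (certEvenDvd5Log8.N + 1),
    (if n.Coprime 5 then (Λ n : ℝ) / Real.sqrt n else 0) ≤ certEvenDvd5Log8.wbar n := by
  intro n hn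
  have hnN : n < 9 := by simpa [show certEvenDvd5Log8.N = 8 from rfl] using Finset.mem_range.1 hn
  have h7 : ∀ k < 8, (Λ k : ℝ) / Real.sqrt k ≤ wbar7 k := fun k hk ↦
    wbar7_ge 7 le_rfl k (Finset.mem_range.2 (by omega))
  unfold JointCert.wbar
  rw [show certEvenDvd5Log8.D = 1048576 from rfl]
  interval_cases n
  · rw [if_neg (by decide), show certEvenDvd5Log8.weights.getD 0 0 = 0 from rfl]
    norm_num
  · rw [if_pos (by decide), show certEvenDvd5Log8.weights.getD 1 0 = 0 from rfl]
    exact (h7 1 (by norm_num)).trans (by norm_num [wbar7])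
  · rw [if_pos (by decide), show certEvenDvd5Log8.weights.getD 2 0 = 513950 from rfl]
    exact (h7 2 (by norm_num)).trans (by norm_num [wbar7])
  · rw [if_pos (by decide), show certEvenDvd5Log8.weights.getD 3 0 = 665112 from rfl]
    exact (h7 3 (by norm_num)).trans (by norm_num [wbar7])
  · rw [if_pos (by decide), show certEvenDvd5Log8.weights.getD 4 0 = 363409 from rfl]
    exact (h7 4 (by norm_num)).trans (by norm_num [wbar7])
  · rw [if_neg (by decide), show certEvenDvd5Log8.weights.getD 5 0 = 0 from rfl]
    norm_num
  · rw [if_pos (by decide), show certEvenDvd5Log8.weights.getD 6 0 = 0 from rfl]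
    exact (h7 6 (by norm_num)).trans (by norm_num [wbar7])
  · rw [if_pos (by decide), show certEvenDvd5Log8.weights.getD 7 0 = 771213 from rfl]
    exact (h7 7 (by norm_num)).trans (by norm_num [wbar7])
  · rw [if_pos (by decide), show certEvenDvd5Log8.weights.getD 8 0 = 256975 from rfl]
    simpa using vonMangoldt_eight_div_sqrt_le

/-- The weights of `certEvenDvd7Log8` dominate `Λ(n)/√n` on the `n ≤ 8` prime to `7`; the other weights are `0`. [folklore] -/
theorem certEvenDvd7Log8_hw : ∀ n ∈ Finset.range (certEvenDvd7Log8.N + 1),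
    (if n.Coprime 7 then (Λ n : ℝ) / Real.sqrt n else 0) ≤ certEvenDvd7Log8.wbar n := by
  intro n hn
  have hnN : n < 9 := by simpa [show certEvenDvd7Log8.N = 8 from rfl] using Finset.mem_range.1 hn
  have h7 : ∀ k < 8, (Λ k : ℝ) / Real.sqrt k ≤ wbar7 k := fun k hk ↦
    wbar7_ge 7 le_rfl k (Finset.mem_range.2 (by omega))
  unfold JointCert.wbar
  rw [show certEvenDvd7Log8.D = 1048576 from rfl]
  interval_cases n
  · rw [if_neg (by decide), show certEvenDvd7Log8.weights.getD 0 0 = 0 from rfl]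
    norm_num
  · rw [if_pos (by decide), show certEvenDvd7Log8.weights.getD 1 0 = 0 from rfl]
    exact (h7 1 (by norm_num)).trans (by norm_num [wbar7])
  · rw [if_pos (by decide), show certEvenDvd7Log8.weights.getD 2 0 = 513950 from rfl]
    exact (h7 2 (by norm_num)).trans (by norm_num [wbar7])
  · rw [if_pos (by decide), show certEvenDvd7Log8.weights.getD 3 0 = 665112 from rfl]
    exact (h7 3 (by norm_num)).trans (by norm_num [wbar7])
  · rw [if_pos (by decide), show certEvenDvd7Log8.weights.getD 4 0 = 363409 from rfl]
    exact (h7 4 (by norm_num)).trans (by norm_num [wbar7])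
  · rw [if_pos (by decide), show certEvenDvd7Log8.weights.getD 5 0 = 754726 from rfl]
    exact (h7 5 (by norm_num)).trans (by norm_num [wbar7])
  · rw [if_pos (by decide), show certEvenDvd7Log8.weights.getD 6 0 = 0 from rfl]
    exact (h7 6 (by norm_num)).trans (by norm_num [wbar7])
  · rw [if_neg (by decide), show certEvenDvd7Log8.weights.getD 7 0 = 0 from rfl]
    norm_num
  · rw [if_pos (by decide), show certEvenDvd7Log8.weights.getD 8 0 = 256975 from rfl]
    simpa using vonMangoldt_eight_div_sqrt_le

/-- The weights of `certEvenDvd10Log8` dominate `Λ(n)/√n` on the `n ≤ 8` prime to `10`; the other weights are `0`. [folklore] -/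
theorem certEvenDvd10Log8_hw : ∀ n ∈ Finset.range (certEvenDvd10Log8.N + 1),
    (if n.Coprime 10 then (Λ n : ℝ) / Real.sqrt n else 0) ≤ certEvenDvd10Log8.wbar n := by
  intro n hn
  have hnN : n < 9 := by simpa [show certEvenDvd10Log8.N = 8 from rfl] using Finset.mem_range.1 hn
  have h7 : ∀ k < 8, (Λ k : ℝ) / Real.sqrt k ≤ wbar7 k := fun k hk ↦
    wbar7_ge 7 le_rfl k (Finset.mem_range.2 (by omega))
  unfold JointCert.wbar
  rw [show certEvenDvd10Log8.D = 1048576 from rfl]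
  interval_cases n
  · rw [if_neg (by decide), show certEvenDvd10Log8.weights.getD 0 0 = 0 from rfl]
    norm_num
  · rw [if_pos (by decide), show certEvenDvd10Log8.weights.getD 1 0 = 0 from rfl]
    exact (h7 1 (by norm_num)).trans (by norm_num [wbar7])
  · rw [if_neg (by decide), show certEvenDvd10Log8.weights.getD 2 0 = 0 from rfl]
    norm_num
  · rw [if_pos (by decide), show certEvenDvd10Log8.weights.getD 3 0 = 665112 from rfl]
    exact (h7 3 (by norm_num)).trans (by norm_num [wbar7])
  · rw [if_neg (by decide), show certEvenDvd10Log8.weights.getD 4 0 = 0 from rfl]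
    norm_num
  · rw [if_neg (by decide), show certEvenDvd10Log8.weights.getD 5 0 = 0 from rfl]
    norm_num
  · rw [if_neg (by decide), show certEvenDvd10Log8.weights.getD 6 0 = 0 from rfl]
    norm_num
  · rw [if_pos (by decide), show certEvenDvd10Log8.weights.getD 7 0 = 771213 from rfl]
    exact (h7 7 (by norm_num)).trans (by norm_num [wbar7])
  · rw [if_neg (by decide), show certEvenDvd10Log8.weights.getD 8 0 = 0 from rfl]
    norm_num

/-- The weights of `certEvenDvd15Log8` dominate `Λ(n)/√n` on the `n ≤ 8` prime to `15`; the other weights are `0`. [folklore] -/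
theorem certEvenDvd15Log8_hw : ∀ n ∈ Finset.range (certEvenDvd15Log8.N + 1),
    (if n.Coprime 15 then (Λ n : ℝ) / Real.sqrt n else 0) ≤ certEvenDvd15Log8.wbar n := by
  intro n hn
  have hnN : n < 9 := by simpa [show certEvenDvd15Log8.N = 8 from rfl] using Finset.mem_range.1 hn
  have h7 : ∀ k < 8, (Λ k : ℝ) / Real.sqrt k ≤ wbar7 k := fun k hk ↦
    wbar7_ge 7 le_rfl k (Finset.mem_range.2 (by omega))
  unfold JointCert.wbar
  rw [show certEvenDvd15Log8.D = 1048576 from rfl]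
  interval_cases n
  · rw [if_neg (by decide), show certEvenDvd15Log8.weights.getD 0 0 = 0 from rfl]
    norm_num
  · rw [if_pos (by decide), show certEvenDvd15Log8.weights.getD 1 0 = 0 from rfl]
    exact (h7 1 (by norm_num)).trans (by norm_num [wbar7])
  · rw [if_pos (by decide), show certEvenDvd15Log8.weights.getD 2 0 = 513950 from rfl]
    exact (h7 2 (by norm_num)).trans (by norm_num [wbar7])
  · rw [if_neg (by decide), show certEvenDvd15Log8.weights.getD 3 0 = 0 from rfl]
    norm_num
  · rw [if_pos (by decide), show certEvenDvd15Log8.weights.getD 4 0 = 363409 from rfl]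
    exact (h7 4 (by norm_num)).trans (by norm_num [wbar7])
  · rw [if_neg (by decide), show certEvenDvd15Log8.weights.getD 5 0 = 0 from rfl]
    norm_num
  · rw [if_neg (by decide), show certEvenDvd15Log8.weights.getD 6 0 = 0 from rfl]
    norm_num
  · rw [if_pos (by decide), show certEvenDvd15Log8.weights.getD 7 0 = 771213 from rfl]
    exact (h7 7 (by norm_num)).trans (by norm_num [wbar7])
  · rw [if_pos (by decide), show certEvenDvd15Log8.weights.getD 8 0 = 256975 from rfl]
    simpa using vonMangoldt_eight_div_sqrt_le

/-! ## The budgets -/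

/-- The budget of `certEvenDvd5Log8`: `log π − (-4.22745354) − Clow/D + RHO/D = 4.238248 ≤ log 70` (`log 70 ≥ 3 log 2 + 2 log 3 − (72 − 70)/70 = 4.248095`). [folklore] -/
theorem certEvenDvd5Log8_budget :
    Real.log Real.pi - (-4.22745354) - (certEvenDvd5Log8.Clow : ℝ) / certEvenDvd5Log8.D + (certEvenDvd5Log8.RHO : ℝ) / certEvenDvd5Log8.D ≤
      Real.log (70 : ℕ) := by
  have hπ := Literature.Analysis.SpecialFunctions.Real.log_pi_le
  have h2 := Real.log_two_gt_d9
  have h3 := Real.log_three_gt_d9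
  have hl : Real.log ((72 : ℝ) / 70) ≤ 72 / 70 - 1 := Real.log_le_sub_one_of_pos (by norm_num)
  have hS : Real.log (72 : ℝ) = 3 * Real.log 2 + 2 * Real.log 3 := by
    rw [show (72 : ℝ) = 2 ^ 3 * 3 ^ 2 by norm_num, Real.log_mul (by norm_num) (by norm_num), Real.log_pow, Real.log_pow]
    push_cast
    ring
  rw [Real.log_div (by norm_num) (by norm_num), hS] at hl
  rw [show certEvenDvd5Log8.Clow = 7676640 from rfl, show certEvenDvd5Log8.D = 1048576 from rfl,
    show certEvenDvd5Log8.RHO = 6487622 from rfl]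
  push_cast at *
  linarith

/-- The budget of `certEvenDvd7Log8`: `log π − (-4.22745354) − Clow/D + RHO/D = 4.466694 ≤ log 91` (`log 91 ≥ 5 log 2 + 1 log 3 − (96 − 91)/91 = 4.509403`). [folklore] -/
theorem certEvenDvd7Log8_budget :
    Real.log Real.pi - (-4.22745354) - (certEvenDvd7Log8.Clow : ℝ) / certEvenDvd7Log8.D + (certEvenDvd7Log8.RHO : ℝ) / certEvenDvd7Log8.D ≤
      Real.log (91 : ℕ) := by
  have hπ := Literature.Analysis.SpecialFunctions.Real.log_pi_le
  have h2 := Real.log_two_gt_d9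
  have h3 := Real.log_three_gt_d9
  have hl : Real.log ((96 : ℝ) / 91) ≤ 96 / 91 - 1 := Real.log_le_sub_one_of_pos (by norm_num)
  have hS : Real.log (96 : ℝ) = 5 * Real.log 2 + 1 * Real.log 3 := by
    rw [show (96 : ℝ) = 2 ^ 5 * 3 ^ 1 by norm_num, Real.log_mul (by norm_num) (by norm_num), Real.log_pow, Real.log_pow]
    push_cast
    ring
  rw [Real.log_div (by norm_num) (by norm_num), hS] at hl
  rw [show certEvenDvd7Log8.Clow = 7676640 from rfl, show certEvenDvd7Log8.D = 1048576 from rfl,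
    show certEvenDvd7Log8.RHO = 6727165 from rfl]
  push_cast at *
  linarith

/-- The budget of `certEvenDvd10Log8`: `log π − (-4.22745354) − Clow/D + RHO/D = 3.343329 ≤ log 30` (`log 30 ≥ 5 log 2 + 0 log 3 − (32 − 30)/30 = 3.399069`). [folklore] -/
theorem certEvenDvd10Log8_budget :
    Real.log Real.pi - (-4.22745354) - (certEvenDvd10Log8.Clow : ℝ) / certEvenDvd10Log8.D + (certEvenDvd10Log8.RHO : ℝ) / certEvenDvd10Log8.D ≤
      Real.log (30 : ℕ) := by
  have hπ := Literature.Analysis.SpecialFunctions.Real.log_pi_le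
  have h2 := Real.log_two_gt_d9
  have h3 := Real.log_three_gt_d9
  have hl : Real.log ((32 : ℝ) / 30) ≤ 32 / 30 - 1 := Real.log_le_sub_one_of_pos (by norm_num)
  have hS : Real.log (32 : ℝ) = 5 * Real.log 2 + 0 * Real.log 3 := by
    rw [show (32 : ℝ) = 2 ^ 5 * 3 ^ 0 by norm_num, Real.log_mul (by norm_num) (by norm_num), Real.log_pow, Real.log_pow]
    push_cast
    ring
  rw [Real.log_div (by norm_num) (by norm_num), hS] at hl
  rw [show certEvenDvd10Log8.Clow = 7676640 from rfl, show certEvenDvd10Log8.D = 1048576 from rfl,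
    show certEvenDvd10Log8.RHO = 5549232 from rfl]
  push_cast at *
  linarith

/-- The budget of `certEvenDvd15Log8`: `log π − (-4.22745354) − Clow/D + RHO/D = 3.639415 ≤ log 45` (`log 45 ≥ 4 log 2 + 1 log 3 − (48 − 45)/45 = 3.804534`). [folklore] -/
theorem certEvenDvd15Log8_budget :
    Real.log Real.pi - (-4.22745354) - (certEvenDvd15Log8.Clow : ℝ) / certEvenDvd15Log8.D + (certEvenDvd15Log8.RHO : ℝ) / certEvenDvd15Log8.D ≤
      Real.log (45 : ℕ) := by
  have hπ := Literature.Analysis.SpecialFunctions.Real.log_pi_le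
  have h2 := Real.log_two_gt_d9
  have h3 := Real.log_three_gt_d9
  have hl : Real.log ((48 : ℝ) / 45) ≤ 48 / 45 - 1 := Real.log_le_sub_one_of_pos (by norm_num)
  have hS : Real.log (48 : ℝ) = 4 * Real.log 2 + 1 * Real.log 3 := by
    rw [show (48 : ℝ) = 2 ^ 4 * 3 ^ 1 by norm_num, Real.log_mul (by norm_num) (by norm_num), Real.log_pow, Real.log_pow]
    push_cast
    ring
  rw [Real.log_div (by norm_num) (by norm_num), hS] at hl
  rw [show certEvenDvd15Log8.Clow = 7676640 from rfl, show certEvenDvd15Log8.D = 1048576 from rfl,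
    show certEvenDvd15Log8.RHO = 5859701 from rfl]
  push_cast at *
  linarith
end UniformFloor

end Summit.Ventures.WeilGRH

end
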